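import Summits.ValiantsHypothesis.ValiantsHypothesis.Theorems.KPlusLogSqLawValuativeDoorSidonTwoSharp

/-!
# LINE `valuative_door` (crux `WeakLifting`, stmt-ValiantsHypothesis-19561) — preliminaries for the NON-SIDON witness:
# a table form of termwise dominance, three-term valuation identities, and the 3-adic absolute value of `ℚ`

HONEST FRAMING.  Helper (cell `pub-symmetroid`, seat val-sym-lift-p1 g23, 2026-08-29; `--supports 19561 --as helper`).  Small tools for
`…NonSidonWitness` (an explicit `K = 5` symmetric pencil on the non-Sidon support `(0,3,4,8,14)` with `14` dominant exponents, i.e.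
`npEdges = 13 > 3K − 4`): `dominant_of_table` (dominance of `E` from a table of exact coefficient sizes `w^{y E'}` and one integer slope),
`abv_sub_eq_first/second`, `abv_three_eq_first/second/third` (`v (x + y − 2z)` when one term is strictly the largest; the `2z` cases use
`v 2 = 1`), and `threeAdicRat_unfolded : ∃ w : AbsoluteValue ℚ ℝ, IsNonarchimedean w ∧ w 3 < 1 ∧ w 2 = 1` (Mathlib's `padicNorm 3` cast to
`ℝ`).  Calibration only; no bearing on vW / vB, `TropicalB`, `MatrixDescartes` (18050) or VP ≠ VNP.  [elementary / folklore]
-/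

set_option linter.dupNamespace false
set_option autoImplicit false

namespace Summit.ValiantsHypothesis.ValiantsHypothesis.Theorems.KPlusLogSqLaw.ValDoor

open Polynomial Finset Matrix
open scoped BigOperators Classical

variable {F : Type*} [Field F]

/-! ## §1 Dominance from a table of exact sizes -/

/-- **dominance from a size table.**  If every support exponent of `f` is a pair sum `d p + d q`, the coefficient at each pair sum has
size at most `w^{y(d p + d q)}`, the coefficient at `E` has size exactly `w^n`, and at the integer slope `s` the target beats every other pair
sum (`n + s·(d p + d q) < y(d p + d q) + s·E`), then `E` is a dominant exponent of `f` (radius `w^{-s}`). [elementary] -/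
theorem dominant_of_table (v : AbsoluteValue F ℝ) {w : ℝ} (hw0 : 0 < w) (hw1 : w < 1) (f : F[X]) {K : ℕ} (d : Fin K → ℕ)
    (y : ℕ → ℕ) (E n s : ℕ) (hsupp : ∀ E' ∈ f.support, ∃ p q : Fin K, E' = d p + d q)
    (hbound : ∀ p q : Fin K, v (f.coeff (d p + d q)) ≤ w ^ y (d p + d q)) (hval : v (f.coeff E) = w ^ n)
    (hineq : ∀ p q : Fin K, d p + d q ≠ E → n + s * (d p + d q) < y (d p + d q) + s * E) :
    E ∈ f.support ∧ ∃ r : ℝ, 0 < r ∧ ∀ E' ∈ f.support, E' ≠ E → v (f.coeff E') * r ^ E' < v (f.coeff E) * r ^ E := by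
  refine ⟨Polynomial.mem_support_iff.2 fun h0 => ?_, w⁻¹ ^ s, pow_pos (inv_pos.2 hw0) s, fun E' hE' hne => ?_⟩
  · rw [h0, map_zero] at hval
    exact absurd hval (ne_of_lt (pow_pos hw0 n))
  · obtain ⟨p, q, rfl⟩ := hsupp E' hE'
    rw [hval]
    have hr : 0 < (w⁻¹ ^ s) ^ (d p + d q) := pow_pos (pow_pos (inv_pos.2 hw0) s) _
    exact lt_of_le_of_lt (mul_le_mul_of_nonneg_right (hbound p q) hr.le) (pow_mul_lt_of_ineq hw0 hw1 (hineq p q hne))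

/-! ## §2 Valuation identities for two and three terms -/

/-- `v (x − y) = v x` when `v y < v x`. [folklore] -/
theorem abv_sub_eq_first (v : AbsoluteValue F ℝ) (hv : IsNonarchimedean v) {x y : F} (h : v y < v x) : v (x - y) = v x := by
  rw [sub_eq_add_neg, abv_add_eq_left_of_lt v hv (by rwa [v.map_neg])]

/-- `v (x − y) = v y` when `v x < v y`. [folklore] -/
theorem abv_sub_eq_second (v : AbsoluteValue F ℝ) (hv : IsNonarchimedean v) {x y : F} (h : v x < v y) : v (x - y) = v y := by
  rw [sub_eq_add_neg, add_comm, abv_add_eq_left_of_lt v hv (by rwa [v.map_neg]), v.map_neg]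

/-- `v (x + y − 2z) = v x` when `v y, v (2z) < v x`. [folklore] -/
theorem abv_three_eq_first (v : AbsoluteValue F ℝ) (hv : IsNonarchimedean v) {x y z : F} (hy : v y < v x) (hz : v (2 * z) < v x) :
    v (x + y - 2 * z) = v x := by
  have h1 : v (x + y) = v x := abv_add_eq_left_of_lt v hv hy
  rw [sub_eq_add_neg, abv_add_eq_left_of_lt v hv (by rw [v.map_neg, h1]; exact hz), h1]

/-- `v (x + y − 2z) = v y` when `v x, v (2z) < v y`. [folklore] -/
theorem abv_three_eq_second (v : AbsoluteValue F ℝ) (hv : IsNonarchimedean v) {x y z : F} (hx : v x < v y) (hz : v (2 * z) < v y) :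
    v (x + y - 2 * z) = v y := by
  rw [add_comm x y]
  exact abv_three_eq_first v hv hx hz

/-- `v (x + y − 2z) = v (2z)` when `v x, v y < v (2z)`. [folklore] -/
theorem abv_three_eq_third (v : AbsoluteValue F ℝ) (hv : IsNonarchimedean v) {x y z : F} (hx : v x < v (2 * z)) (hy : v y < v (2 * z)) :
    v (x + y - 2 * z) = v (2 * z) := by
  have e : x + y - 2 * z = -(2 * z) + (x + y) := by ring
  have h1 : v (x + y) < v (2 * z) := lt_of_le_of_lt (hv _ _) (max_lt hx hy)
  rw [e, abv_add_eq_left_of_lt v hv (by rw [v.map_neg]; exact h1), v.map_neg]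

/-! ## §3 The 3-adic absolute value of `ℚ`, real-valued -/

/-- **the 3-adic absolute value on `ℚ`** (Mathlib's `padicNorm 3`, cast to `ℝ`): non-archimedean, `|3| < 1`, `|2| = 1`. [folklore] -/
theorem threeAdicRat_unfolded : ∃ w : AbsoluteValue ℚ ℝ, IsNonarchimedean w ∧ w 3 < 1 ∧ w 2 = 1 := by
  haveI h3 : Fact (Nat.Prime 3) := ⟨by norm_num⟩
  haveI h2 : Fact (Nat.Prime 2) := ⟨by norm_num⟩
  refine ⟨{ toFun := fun x => ((padicNorm 3 x : ℚ) : ℝ)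
            map_mul' := fun x y => by simp only [padicNorm.mul, Rat.cast_mul]
            nonneg' := fun x => by exact_mod_cast padicNorm.nonneg x
            eq_zero' := fun x => ⟨fun h => padicNorm.zero_of_padicNorm_eq_zero (by exact_mod_cast h),
              fun h => by simp [h]⟩
            add_le' := fun x y => by exact_mod_cast padicNorm.triangle_ineq x y }, ?_, ?_, ?_⟩
  · intro x y
    show ((padicNorm 3 (x + y) : ℚ) : ℝ) ≤ max ((padicNorm 3 x : ℚ) : ℝ) ((padicNorm 3 y : ℚ) : ℝ)
    have h := padicNorm.nonarchimedean (p := 3) (q := x) (r := y)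
    rcases le_max_iff.1 h with h' | h'
    · exact le_max_of_le_left (by exact_mod_cast h')
    · exact le_max_of_le_right (by exact_mod_cast h')
  · show ((padicNorm 3 (3 : ℚ) : ℚ) : ℝ) < 1
    have h := padicNorm.padicNorm_p_lt_one (p := 3) (by norm_num)
    exact_mod_cast h
  · show ((padicNorm 3 (2 : ℚ) : ℚ) : ℝ) = 1
    have h := padicNorm.padicNorm_of_prime_of_ne (p := 3) (q := 2) (by norm_num)
    exact_mod_cast h

end Summit.ValiantsHypothesis.ValiantsHypothesis.Theorems.KPlusLogSqLaw.ValDoor
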